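import Summits.ResolutionOfSingularities.ResolutionOfSingularities.Theorems.HomologicalConductorNoZenoSplitCountDrop
import Summits.ResolutionOfSingularities.ResolutionOfSingularities.Theorems.HomologicalConductorNoZenoMinResolutionCount
import Literature.AlgebraicGeometry.Resolution.ExceptionalCurvePoints
import Literature.AlgebraicGeometry.Resolution.PrimeDivisorIdeals
import Literature.AlgebraicGeometry.Resolution.FiniteBirationalNormal
import Literature.AlgebraicGeometry.Resolution.ResolutionGlue
import HarnessLib

/-!
# Crux `NoZenoR` (stmt-ResolutionOfSingularities-19943), β layer, `stub_L1wCoreF` descent brick DOM: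
# THE MINIMAL RESOLUTION HAS THE FEWEST (SPLIT-WEIGHTED) EXCEPTIONAL CURVES

Route `ResolutionOfSingularities/HomologicalConductor`, crux chain W4.4.  OURS (cell res-hironaka, seat res-L0-w44-stub-2,
(L1)-PREP v4 §5); AI-written, weaker than expert review; nothing here is a statement of the manuscript under review
(Hironaka 2017).  Def-free, `--supports 19943 --as helper`.

Let `T` be a Noetherian local domain of Krull dimension `2`, `ρ : Y → Spec T` a MINIMAL resolution and `π : X → Spec T` ANY
resolution.  The factorisation `h : X → Y` (`h ≫ ρ = π`) is proper and birational, hence surjective; over the generic point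
`η` of an integral exceptional curve of `ρ` any point `ξ ∈ h⁻¹(η)` is again the generic point of an integral exceptional
curve (of `π`), and `𝒪_{Y,η} → 𝒪_{X,ξ}` is an ISOMORPHISM: `𝒪_{Y,η}` is a discrete valuation ring of the common function field
`K(Y) = K(X)` and the local ring `𝒪_{X,ξ} ⊆ K(X)` dominates it (a valuation ring is maximal for domination).  Hence
`κ(ξ) ≅ κ(η)` over `κ(𝔪)`, the split weights agree, and a choice of `ξ` over each `η` is a weight-preserving injection
`excCurvePoints ρ ↪ excCurvePoints π`:

* `surjective_of_valuationRing_of_fac` — the algebra: a local homomorphism `φ : A → B` from a valuation ring into a local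
  ring `B ⊆ K` (`K` a field), compatible with a SURJECTION of fraction fields `Frac A → K`, is surjective;
* `isBirational_of_fac`, `surjective_base_of_fac` — `h` is birational and surjective;
* `mem_excCurvePoints_of_fac` — `h ξ ∈ excCurvePoints ρ ⇒ ξ ∈ excCurvePoints π`;
* `bijective_stalkMap_of_fac` — `𝒪_{Y,h ξ} ≅ 𝒪_{X,ξ}` at such `ξ`; `splitWeight_eq_of_fac` — `splitWeight π ξ = splitWeight ρ (h ξ)`;
* **`splitExcCount_le_of_isMinimalResolution_of_isResolution`** — `(excCurvePoints ρ).Finite ∧ splitExcCount ρ ≤ splitExcCount π`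
  (plain count: `ncard_excCurvePoints_le_of_isMinimalResolution_of_isResolution`; consumer form
  `hasSplitExcCurveCountLE_of_isResolution`), via res-L0-w44-lead-1's arithmetic `splitExcCount_le_of_mapsTo`
  (`…NoZenoSplitCountDrop`).

Consumed by the (B2) descent of `stub_L1wCoreF` in every variant («`N^s`(minimal resolution of `D′`) ≤ `N^s`(the explicit
resolution of `D′` cut out of `X¹`)», PREP v4 §5) and by the étale-local measure of PREP v4 §4.
References (context): J. Lipman, Publ. Math. IHÉS 36 (1969) §4 Thm (4.1) p. 204 (every desingularization dominates the minimal
one) and §27 Cor. (27.3) p. 277 [`Lipman1969`]; O. Zariski, P. Samuel, *Commutative Algebra* II, Ch. VI §3 (a valuation ring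
is maximal for domination) [folklore].
-/

noncomputable section

-- single-problem summit: the doubled namespace component `ResolutionOfSingularities` is forced
set_option linter.dupNamespace false

namespace Summit.ResolutionOfSingularities.ResolutionOfSingularities.Theorems.NoZeno.ExcCount

open CategoryTheory AlgebraicGeometry TopologicalSpace Topology IsLocalRing
open Literature.AlgebraicGeometry.Resolution

universe u

/-! ## §1 Algebra: a valuation ring is maximal for domination -/

/-- **A valuation ring is maximal for domination (relative form).**  Let `A` be a valuation ring with fraction field `L`,
`B` a local ring with an injective map to a field `K`, `φ : A → B` a LOCAL homomorphism and `ψ : L → K` a SURJECTIVE ring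
map with `ψ ∘ (A → L) = (B → K) ∘ φ`.  Then `φ` is surjective: an element `b = ψ(a/s)` of `B` has either `s ∣ a` in `A`
(then `b = φ(a/s)`) or `a ∣ s`, `s = a c` with `c` a non-unit — but then `b · φ(c) = 1` makes `φ(c)` a unit, contradicting
locality. [folklore] -/
theorem surjective_of_valuationRing_of_fac {A B L K : Type*} [CommRing A] [IsDomain A] [ValuationRing A]
    [CommRing B] [IsLocalRing B] [Field L] [Field K] [Algebra A L] [IsFractionRing A L] [Algebra B K]
    (hBK : Function.Injective (algebraMap B K)) (φ : A →+* B) [IsLocalHom φ] (ψ : L →+* K)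
    (hψ : Function.Surjective ψ) (hsq : ∀ a : A, ψ (algebraMap A L a) = algebraMap B K (φ a)) :
    Function.Surjective φ := by
  intro b
  obtain ⟨l, hl⟩ := hψ (algebraMap B K b)
  obtain ⟨a, s, hs, rfl⟩ := IsFractionRing.div_surjective (A := A) l
  have hs0 : s ≠ 0 := nonZeroDivisors.ne_zero hs
  have hsL : algebraMap A L s ≠ 0 :=
    fun e => hs0 ((IsFractionRing.injective A L) (by rw [e, map_zero]))
  obtain ⟨c, hc | hc⟩ := ValuationRing.cond a s
  · -- `a * c = s`: the fraction is `1 / c`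
    have ha0 : a ≠ 0 := by rintro rfl; exact hs0 (by rw [← hc, zero_mul])
    have hfrac : algebraMap A L a / algebraMap A L s * algebraMap A L c = 1 := by
      rw [← hc, map_mul]
      have haL : algebraMap A L a ≠ 0 :=
        fun e => ha0 ((IsFractionRing.injective A L) (by rw [e, map_zero]))
      have hcL : algebraMap A L c ≠ 0 := by
        intro e
        apply hsL
        rw [← hc, map_mul, e, mul_zero]
      field_simp
    by_cases hcu : IsUnit c
    · obtain ⟨u, rfl⟩ := hcu
      refine ⟨↑u⁻¹, hBK ?_⟩
      rw [← hsq, ← hl]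
      congr 1
      calc algebraMap A L (↑u⁻¹ : A)
          = algebraMap A L a / algebraMap A L s * (algebraMap A L (u : A) * algebraMap A L (↑u⁻¹ : A)) := by
            rw [← mul_assoc, hfrac, one_mul]
        _ = algebraMap A L a / algebraMap A L s := by
            rw [← map_mul, Units.mul_inv, map_one, mul_one]
    · exfalso
      -- `b * φ c = 1` in `B`, so `φ c` is a unit, so `c` is a unit
      have hprod : algebraMap B K (b * φ c) = algebraMap B K 1 := by
        rw [map_mul, map_one, ← hl, ← hsq, ← map_mul, hfrac, map_one]
      have hunit : IsUnit (φ c) := IsUnit.of_mul_eq_one_right b (hBK hprod)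
      exact hcu (isUnit_of_map_unit φ c hunit)
  · -- `s * c = a`: the fraction is `c`
    refine ⟨c, hBK ?_⟩
    rw [← hsq, ← hl, ← hc, map_mul, mul_div_cancel_left₀ _ hsL]

/-! ## §2 The factorisation of a resolution through another is birational and surjective -/

section Fac

variable {S X Y : Scheme.{u}} [IsIntegral S] [IsIntegral X] [IsIntegral Y]
  {ρ : Y ⟶ S} {h : X ⟶ Y}

/-- **Two out of three for birationality**: if `h ≫ ρ` and `ρ` are birational and `S`, `X`, `Y` are integral, then `h`
is birational (an isomorphism over `ρ⁻¹(W)` for `W` the intersection of the two dense opens). [folklore] -/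
theorem isBirational_of_fac (hπ : IsBirational (h ≫ ρ)) (hρ : IsBirational ρ) : IsBirational h := by
  obtain ⟨U, hU, hU', hisoU⟩ := hπ
  obtain ⟨V, hV, hV', hisoV⟩ := hρ
  -- the common dense open `W`
  set W : S.Opens := U ⊓ V with hW
  have hgenW : genericPoint S ∈ W :=
    ⟨((genericPoint_spec S).mem_open_set_iff U.isOpen).mpr (by rw [Set.univ_inter]; exact hU.nonempty),
      ((genericPoint_spec S).mem_open_set_iff V.isOpen).mpr (by rw [Set.univ_inter]; exact hV.nonempty)⟩
  haveI : IsDominant ρ := IsBirational.isDominant ⟨V, hV, hV', hisoV⟩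
  haveI : IsDominant (h ≫ ρ) := IsBirational.isDominant ⟨U, hU, hU', hisoU⟩
  have hρgen : ρ.base (genericPoint Y) = genericPoint S := Literature.AlgebraicGeometry.Motives.RatFn.genericPoint_eq_of_isDominant ρ
  have hπgen : (h ≫ ρ).base (genericPoint X) = genericPoint S :=
    Literature.AlgebraicGeometry.Motives.RatFn.genericPoint_eq_of_isDominant (h ≫ ρ)
  refine ⟨ρ ⁻¹ᵁ W, ?_, ?_, ?_⟩
  · -- dense in `Y`: a non-empty open of an irreducible space
    refine (ρ ⁻¹ᵁ W).2.dense ⟨genericPoint Y, ?_⟩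
    show ρ.base (genericPoint Y) ∈ W
    rw [hρgen]; exact hgenW
  · -- `h⁻¹(ρ⁻¹ W) = (h ≫ ρ)⁻¹ W` is dense in `X`
    rw [← Scheme.Hom.comp_preimage]
    refine ((h ≫ ρ) ⁻¹ᵁ W).2.dense ⟨genericPoint X, ?_⟩
    show (h ≫ ρ).base (genericPoint X) ∈ W
    rw [hπgen]; exact hgenW
  · -- `(h ∣_ ρ⁻¹W) ≫ (ρ ∣_ W) = (h ≫ ρ) ∣_ W`, and both `ρ ∣_ W`, `(h ≫ ρ) ∣_ W` are isomorphisms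
    haveI h1 : IsIso (ρ ∣_ W) := isIso_morphismRestrict_of_le ρ hisoV inf_le_right
    haveI h2 : IsIso ((h ≫ ρ) ∣_ W) := isIso_morphismRestrict_of_le (h ≫ ρ) hisoU inf_le_left
    haveI h3 : IsIso ((h ∣_ ρ ⁻¹ᵁ W) ≫ (ρ ∣_ W)) := by
      rw [← morphismRestrict_comp]; exact h2
    exact IsIso.of_isIso_comp_right (h ∣_ ρ ⁻¹ᵁ W) (ρ ∣_ W)

/-- The factorisation of a proper birational morphism through a proper birational one is proper, birational and
**surjective** (closed with dense image). [folklore] -/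
theorem surjective_base_of_fac [IsProper ρ] [IsProper (h ≫ ρ)] (hπ : IsBirational (h ≫ ρ)) (hρ : IsBirational ρ) :
    Function.Surjective h.base := by
  haveI : IsProper h := IsProper.of_comp h ρ
  haveI : IsDominant h := (isBirational_of_fac hπ hρ).isDominant
  rw [← Set.range_eq_univ, ← h.isClosedMap.isClosed_range.closure_eq]
  exact h.denseRange.closure_range

end Fac

/-! ## §3 Exceptional curves and their local rings along the factorisation -/

section Exc

variable {T : Type} [CommRing T] [IsNoetherianRing T] [IsDomain T] [IsLocalRing T]
  {X Y : Scheme.{0}} {ρ : Y ⟶ Spec (.of T)} {h : X ⟶ Y}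

/-- A point which is minimal for the specialisation preorder of a scheme is a closed point. [folklore] -/
theorem isClosed_singleton_of_height_eq_zero {Z : Scheme.{0}} {z : Z} (hz : Order.height z = 0) :
    IsClosed ({z} : Set Z) := by
  rw [Order.height_eq_zero] at hz
  rw [← closure_subset_iff_isClosed]
  intro x hx
  have hzx : z ⤳ x := specializes_iff_mem_closure.mpr hx
  have hle : x ≤ z := Scheme.le_iff_specializes.mpr hzx
  have hxz : x ⤳ z := Scheme.le_iff_specializes.mp (hz hle)
  exact (hxz.antisymm hzx).eq

/-- **Over an exceptional curve of `ρ` lies an exceptional curve of `π = h ≫ ρ`**: if `h ξ ∈ excCurvePoints ρ` then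
`ξ ∈ excCurvePoints (h ≫ ρ)` (`ξ` lies over the closed point, so `height ξ ≤ 1`; and `ξ` is not a closed point since its
image under the closed map `h` is not). [folklore] -/
theorem mem_excCurvePoints_of_fac (h2 : ringKrullDim T = 2) (hπ : IsResolution (h ≫ ρ)) (hρ : IsResolution ρ)
    {ξ : X} (hξ : h.base ξ ∈ excCurvePoints ρ) : ξ ∈ excCurvePoints (h ≫ ρ) := by
  haveI : IsProper ρ := hρ.isProper
  haveI : IsProper (h ≫ ρ) := hπ.isProper
  haveI : IsProper h := IsProper.of_comp h ρ
  obtain ⟨h𝔪, hht⟩ := hξ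
  have hbase : (h ≫ ρ).base ξ = closedPoint T := h𝔪
  refine ⟨hbase, le_antisymm (hπ.height_le_one_of_base_eq_closedPoint h2 hbase) ?_⟩
  -- `height ξ ≠ 0`
  refine Order.one_le_iff_ne_zero.mpr fun h0 => ?_
  have hcl : IsClosed ({h.base ξ} : Set Y) := by
    rw [← Set.image_singleton]
    exact h.isClosedMap _ (isClosed_singleton_of_height_eq_zero h0)
  have := Scheme.height_of_isClosed hcl
  rw [hht] at this
  exact one_ne_zero this

/-- **The local ring does not change**: for `ρ` a resolution and `π = h ≫ ρ` a resolution of the spectrum of a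
two-dimensional Noetherian local domain, at a point `ξ` over the generic point `h ξ` of an integral exceptional curve of `ρ`
the stalk map `𝒪_{Y,h ξ} → 𝒪_{X,ξ}` is bijective: `𝒪_{Y,h ξ}` is a discrete valuation ring (regular of dimension one) of the
common function field `K(Y) ≅ K(X)` (`h` is birational) dominated by the local ring `𝒪_{X,ξ} ⊆ K(X)`. [folklore] -/
theorem bijective_stalkMap_of_fac (h2 : ringKrullDim T = 2) (hπ : IsResolution (h ≫ ρ)) (hρ : IsResolution ρ)
    {ξ : X} (hξ : h.base ξ ∈ excCurvePoints ρ) : Function.Bijective (h.stalkMap ξ).hom := by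
  haveI : IsIntegral Y := hρ.isIntegral_source
  haveI : IsIntegral X := hπ.isIntegral_source
  -- `𝒪_{Y, h ξ}` is a valuation ring
  have hco : Order.coheight (h.base ξ) = 1 := hρ.coheight_eq_one_of_mem_excCurvePoints h2 hξ
  haveI : IsPrincipalIdealRing (Y.presheaf.stalk (h.base ξ)) :=
    isPrincipalIdealRing_stalk_of_coheight_eq_one hρ.isRegular hco
  haveI : ValuationRing (Y.presheaf.stalk (h.base ξ)) := inferInstance
  -- the function field map `ψ : K(Y) → K(X)` induced by `h` (an isomorphism: `h` is birational)
  have hbir : IsBirational h := isBirational_of_fac hπ.isBirational hρ.isBirational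
  haveI : IsDominant h := hbir.isDominant
  have hgen : h.base (genericPoint X) = genericPoint Y := Literature.AlgebraicGeometry.Motives.RatFn.genericPoint_eq_of_isDominant h
  have hsp' : h.base (genericPoint X) ⤳ genericPoint Y := by rw [hgen]
  have hsp : genericPoint Y ⤳ h.base (genericPoint X) := genericPoint_specializes _
  let ψ : Y.functionField →+* X.functionField :=
    (h.stalkMap (genericPoint X)).hom.comp (Y.presheaf.stalkSpecializes hsp').hom
  have hψ : Function.Surjective ψ := by
    haveI : IsIso (h.stalkMap (genericPoint X)) := hbir.isIso_stalkMap_genericPoint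
    refine (ConcreteCategory.bijective_of_isIso (h.stalkMap (genericPoint X))).2.comp ?_
    -- `stalkSpecializes hsp'` has the right inverse `stalkSpecializes hsp`
    refine Function.RightInverse.surjective (g := (Y.presheaf.stalkSpecializes hsp).hom) fun y => ?_
    change (Y.presheaf.stalkSpecializes hsp ≫ Y.presheaf.stalkSpecializes hsp') y = y
    rw [TopCat.Presheaf.stalkSpecializes_comp]
    -- `stalkSpecializes` of the trivial specialisation is the identity
    have : Y.presheaf.stalkSpecializes (hsp'.trans hsp) = 𝟙 _ :=
      TopCat.Presheaf.stalkSpecializes_refl _ _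
    rw [this]; rfl
  -- the square `ψ ∘ (𝒪_{Y,hξ} → K(Y)) = (𝒪_{X,ξ} → K(X)) ∘ h.stalkMap ξ`
  have hsq : ∀ a : Y.presheaf.stalk (h.base ξ),
      ψ (algebraMap (Y.presheaf.stalk (h.base ξ)) Y.functionField a) =
        algebraMap (X.presheaf.stalk ξ) X.functionField ((h.stalkMap ξ).hom a) := by
    intro a
    have gX : genericPoint X ⤳ ξ := genericPoint_specializes ξ
    change (h.stalkMap (genericPoint X)).hom ((Y.presheaf.stalkSpecializes hsp').hom
        ((Y.presheaf.stalkSpecializes (genericPoint_specializes (h.base ξ))).hom a)) =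
      (X.presheaf.stalkSpecializes gX).hom ((h.stalkMap ξ).hom a)
    rw [← CommRingCat.comp_apply (Y.presheaf.stalkSpecializes _) (Y.presheaf.stalkSpecializes hsp'),
      TopCat.Presheaf.stalkSpecializes_comp]
    exact Scheme.Hom.stalkSpecializes_stalkMap_apply h (genericPoint X) ξ gX a
  have hBK : Function.Injective (algebraMap (X.presheaf.stalk ξ) X.functionField) :=
    IsFractionRing.injective (X.presheaf.stalk ξ) X.functionField
  have hsurj : Function.Surjective (h.stalkMap ξ).hom :=
    surjective_of_valuationRing_of_fac hBK (h.stalkMap ξ).hom ψ hψ hsq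
  refine ⟨fun a b hab => ?_, hsurj⟩
  -- injectivity: `ψ ∘ (𝒪_{Y,hξ} → K(Y))` is injective
  have hAL : Function.Injective (algebraMap (Y.presheaf.stalk (h.base ξ)) Y.functionField) :=
    IsFractionRing.injective (Y.presheaf.stalk (h.base ξ)) Y.functionField
  apply hAL
  apply ψ.injective
  rw [hsq, hsq, hab]

/-- **Split weights are preserved along the factorisation**: `splitWeight (h ≫ ρ) ξ = splitWeight ρ (h ξ)` at a point `ξ`
over an integral exceptional curve of `ρ` (the residue fields `κ(h ξ) ≅ κ(ξ)` are isomorphic over `κ(𝔪)`,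
`bijective_stalkMap_of_fac`; `sepDegree_comp_ringEquiv`). [folklore] -/
theorem splitWeight_eq_of_fac (h2 : ringKrullDim T = 2) (hπ : IsResolution (h ≫ ρ)) (hρ : IsResolution ρ)
    {ξ : X} (hξ : h.base ξ ∈ excCurvePoints ρ) : splitWeight (h ≫ ρ) ξ = splitWeight ρ (h.base ξ) := by
  rw [splitWeight_eq_sepDegree, splitWeight_eq_sepDegree]
  have hcomp : ((h ≫ ρ).residueFieldMap ξ).hom =
      (h.residueFieldMap ξ).hom.comp (ρ.residueFieldMap (h.base ξ)).hom := by
    rw [Scheme.residueFieldMap_comp]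
    rfl
  rw [hcomp]
  -- `h.residueFieldMap ξ` is an isomorphism of fields
  let e : Y.presheaf.stalk (h.base ξ) ≃+* X.presheaf.stalk ξ :=
    RingEquiv.ofBijective (h.stalkMap ξ).hom (bijective_stalkMap_of_fac h2 hπ hρ hξ)
  let ψ : Y.residueField (h.base ξ) ≃+* X.residueField ξ := IsLocalRing.ResidueField.mapEquiv e
  have hψ : (h.residueFieldMap ξ).hom = ψ.toRingHom := RingHom.ext fun x => rfl
  rw [hψ]
  exact sepDegree_comp_ringEquiv _ ψ

end Exc

/-! ## §4 The minimal resolution has the fewest (split-weighted) exceptional curves -/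

/-- **DOM — the minimal resolution has the smallest split count.**  For a Noetherian local domain `T` of Krull dimension
`2`, a minimal resolution `ρ : Y → Spec T` and any resolution `π : X → Spec T` with finitely many integral exceptional
curves: `ρ` has finitely many integral exceptional curves and `splitExcCount ρ ≤ splitExcCount π` (a choice of a point of
`X` over each exceptional generic point of `Y` along the factorisation `X → Y` is a weight-preserving injection;
`splitExcCount_le_of_mapsTo`). [cite: Lipman1969, Theorem (4.1) (p. 204)] -/
theorem splitExcCount_le_of_isMinimalResolution_of_isResolution {T : Type} [CommRing T] [IsNoetherianRing T]
    [IsDomain T] [IsLocalRing T] (h2 : ringKrullDim T = 2) {X Y : Scheme.{0}} {π : X ⟶ Spec (.of T)}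
    {ρ : Y ⟶ Spec (.of T)} (hρ : IsMinimalResolution ρ) (hπ : IsResolution π)
    (hfin : (excCurvePoints π).Finite) :
    (excCurvePoints ρ).Finite ∧ splitExcCount ρ ≤ splitExcCount π := by
  obtain ⟨h, hfac⟩ := hρ.2 X π hπ
  subst hfac
  haveI : IsIntegral X := hπ.isIntegral_source
  haveI : IsIntegral Y := hρ.1.isIntegral_source
  haveI : IsProper ρ := hρ.1.isProper
  haveI : IsProper (h ≫ ρ) := hπ.isProper
  have hsurj : Function.Surjective h.base := surjective_base_of_fac hπ.isBirational hρ.1.isBirational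
  -- a section `φ` of `h` on points
  let φ : Y → X := Function.surjInv hsurj
  have hφ : ∀ y, h.base (φ y) = y := Function.surjInv_eq hsurj
  have hmaps : Set.MapsTo φ (excCurvePoints ρ) (excCurvePoints (h ≫ ρ)) := fun η hη =>
    mem_excCurvePoints_of_fac h2 hπ hρ.1 (by rw [hφ]; exact hη)
  have hinj : Set.InjOn φ (excCurvePoints ρ) := (Function.injective_surjInv hsurj).injOn
  have hw : ∀ η ∈ excCurvePoints ρ, splitWeight ρ η ≤ splitWeight (h ≫ ρ) (φ η) := fun η hη => by
    rw [splitWeight_eq_of_fac h2 hπ hρ.1 (by rw [hφ]; exact hη), hφ]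
  exact ⟨excCurvePoints_finite_of_mapsTo (h ≫ ρ) ρ φ hfin hmaps hinj,
    splitExcCount_le_of_mapsTo (h ≫ ρ) ρ φ hfin hmaps hinj hw⟩

/-- The plain-count form of DOM: a minimal resolution has at most as many integral exceptional curves as any resolution.
[cite: Lipman1969, Theorem (4.1) (p. 204)] -/
theorem ncard_excCurvePoints_le_of_isMinimalResolution_of_isResolution {T : Type} [CommRing T] [IsNoetherianRing T]
    [IsDomain T] [IsLocalRing T] (h2 : ringKrullDim T = 2) {X Y : Scheme.{0}} {π : X ⟶ Spec (.of T)}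
    {ρ : Y ⟶ Spec (.of T)} (hρ : IsMinimalResolution ρ) (hπ : IsResolution π)
    (hfin : (excCurvePoints π).Finite) :
    (excCurvePoints ρ).ncard ≤ (excCurvePoints π).ncard := by
  obtain ⟨h, hfac⟩ := hρ.2 X π hπ
  subst hfac
  haveI : IsIntegral X := hπ.isIntegral_source
  haveI : IsIntegral Y := hρ.1.isIntegral_source
  haveI : IsProper ρ := hρ.1.isProper
  haveI : IsProper (h ≫ ρ) := hπ.isProper
  have hsurj : Function.Surjective h.base := surjective_base_of_fac hπ.isBirational hρ.1.isBirational
  let φ : Y → X := Function.surjInv hsurj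
  have hφ : ∀ y, h.base (φ y) = y := Function.surjInv_eq hsurj
  have hmaps : Set.MapsTo φ (excCurvePoints ρ) (excCurvePoints (h ≫ ρ)) := fun η hη =>
    mem_excCurvePoints_of_fac h2 hπ hρ.1 (by rw [hφ]; exact hη)
  have hinj : Set.InjOn φ (excCurvePoints ρ) := (Function.injective_surjInv hsurj).injOn
  exact Set.ncard_le_ncard_of_injOn φ hmaps hinj hfin

/-- **Consumer form**: if `Spec T` has SOME minimal resolution (e.g. by `Lipman1969_4_1` over a rational singularity), then ANY
resolution `π` with finitely many integral exceptional curves and `splitExcCount π ≤ N` witnesses `HasSplitExcCurveCountLE T N`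
(U8) — the measure may be bounded on a non-minimal resolution. [cite: Lipman1969, Theorem (4.1) (p. 204)] -/
theorem hasSplitExcCurveCountLE_of_isResolution {T : Type} [CommRing T] [IsNoetherianRing T] [IsDomain T]
    [IsLocalRing T] (h2 : ringKrullDim T = 2) (hmin : ∃ (Y : Scheme.{0}) (ρ : Y ⟶ Spec (.of T)), IsMinimalResolution ρ)
    {X : Scheme.{0}} {π : X ⟶ Spec (.of T)} (hπ : IsResolution π) (hfin : (excCurvePoints π).Finite) {N : ℕ}
    (hle : splitExcCount π ≤ N) : HasSplitExcCurveCountLE T N := by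
  obtain ⟨Y, ρ, hρ⟩ := hmin
  obtain ⟨hfinρ, hleρ⟩ := splitExcCount_le_of_isMinimalResolution_of_isResolution h2 hρ hπ hfin
  exact ⟨Y, ρ, hρ, hfinρ, hleρ.trans hle⟩

end Summit.ResolutionOfSingularities.ResolutionOfSingularities.Theorems.NoZeno.ExcCount

end
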